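import Literature.Topology.FourManifolds.InfiniteCyclicCover
import HarnessLib

/-!
# The deck action on the infinite cyclic cover is free and properly discontinuous

For the infinite cyclic cover `X̂ = CircleMaps.CyclicCover f = {(x, s) | f x = exp s}` of a space
`X` along a circle-valued map `f : X → S¹` (`InfiniteCyclicCover.lean`; Hatcher 2002, §1.3) with
its deck action `k +ᵥ (x, s) = (x, s + 2πk)` of `ℤ`:

* `CyclicCover.vadd_eq_self_iff` — **the action is free**: `k +ᵥ p = p ↔ k = 0`;
* `CyclicCover.abs_le_of_vadd_mem` — if `k +ᵥ p ∈ L` with `|level| ≤ a` on `p` and `≤ b` on `L`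
  then `2π|k| ≤ a + b`;
* `CyclicCover.instProperlyDiscontinuousVAdd` — **the action is properly discontinuous**
  (Mathlib's `ProperlyDiscontinuousVAdd`: for compact `K, L ⊆ X̂` only finitely many translates
  `k +ᵥ K` meet `L`), because the continuous level function `level (x, s) = s` is bounded on
  compact sets and `level (k +ᵥ p) = level p + 2πk` (Hatcher 2002, §1.3, pp. 72–73: covering space
  actions; the deck group of a covering acts properly discontinuously, cf. O'Neill 1983, Ch. 7,
  p. 188 and p. 192: "the deck transformation group is a properly discontinuous group").

This is the structure of the groups `Hᵢ ≅ ℤᵇ` acting on the covers `M̂ᵢ` in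
Huang–Huang–Wang–Zhu 2026, §4 (closed subgroups of isometries acting freely and properly
discontinuously with compact quotient `M̂ᵢ/Hᵢ = Mᵢ`), case `b = 1`. Everything is proved; no
definitions besides the instance, no named facts.

## References

* A. Hatcher, *Algebraic Topology*, CUP (2002), §1.3, Prop. 1.39–1.40 and pp. 72–73. [HatcherAT2002]
* B. O'Neill, *Semi-Riemannian Geometry* (1983), Ch. 7, pp. 188–192. [ONeill1983]
* H. Huang, X.-T. Huang, J. Wang, X. Zhu, arXiv:2605.24380 (2026), §4, p. 13. [HuangHuangWangZhu2026]
-/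

noncomputable section

open Set Function Real

namespace Literature.Topology.FourManifolds.CircleMaps.CyclicCover

variable {X : Type*} [TopologicalSpace X] {f : C(X, Circle)}

/-- **The deck action is free**: `k +ᵥ p = p ↔ k = 0` (the level shifts by `2πk ≠ 0`).
[cite: HatcherAT2002, §1.3 Prop. 1.39] -/
theorem vadd_eq_self_iff (k : ℤ) (p : CyclicCover f) : k +ᵥ p = p ↔ k = 0 := by
  refine ⟨fun h ↦ ?_, fun h ↦ by rw [h, zero_vadd]⟩
  have hl := congrArg level h
  rw [level_vadd, add_eq_left, mul_eq_zero] at hl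
  rcases hl with hk | hπ
  · exact_mod_cast hk
  · exact absurd hπ (by positivity)

/-- The stabilisers of the deck action are trivial. [cite: HatcherAT2002, §1.3 Prop. 1.39] -/
theorem stabilizer_eq_bot (p : CyclicCover f) : AddAction.stabilizer ℤ p = ⊥ := by
  rw [eq_bot_iff]
  intro k hk
  rw [AddAction.mem_stabilizer_iff, vadd_eq_self_iff] at hk
  rw [hk]
  exact zero_mem _

/-- **Level bounds control the deck translations**: if `|level p| ≤ a` and `|level (k +ᵥ p)| ≤ b`
then `2π |k| ≤ a + b`. [folklore] -/
theorem two_pi_mul_abs_le_of_abs_level_le {k : ℤ} {p : CyclicCover f} {a b : ℝ}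
    (ha : |level p| ≤ a) (hb : |level (k +ᵥ p)| ≤ b) : 2 * π * |(k : ℝ)| ≤ a + b := by
  rw [level_vadd] at hb
  have h1 : |(k : ℝ) * (2 * π)| ≤ |level p| + |level p + k * (2 * π)| := by
    calc |(k : ℝ) * (2 * π)| = |(level p + k * (2 * π)) - level p| := by ring_nf
      _ ≤ |level p + k * (2 * π)| + |level p| := abs_sub _ _
      _ = |level p| + |level p + k * (2 * π)| := add_comm _ _
  have h2 : |(k : ℝ) * (2 * π)| = 2 * π * |(k : ℝ)| := by
    rw [abs_mul, abs_of_pos (by positivity : (0 : ℝ) < 2 * π), mul_comm]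
  linarith

/-- **The deck action of `ℤ` on the infinite cyclic cover is properly discontinuous**: for compact
`K, L ⊆ X̂` only finitely many translates `k +ᵥ K` meet `L` — the continuous level function is
bounded by `a` on `K` and by `b` on `L`, and `k +ᵥ p ∈ L`, `p ∈ K` force `2π|k| ≤ a + b`
(Hatcher 2002, §1.3, pp. 72–73, covering space actions and properly discontinuous actions;
O'Neill 1983, Ch. 7, p. 192: "the deck transformation group is a properly discontinuous group of
isometries").
[cite: HatcherAT2002, §1.3 pp. 72–73] -/
instance instProperlyDiscontinuousVAdd : ProperlyDiscontinuousVAdd ℤ (CyclicCover f) := by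
  refine ⟨fun {K L} hK hL ↦ ?_⟩
  -- level bounds on `K` and `L`
  obtain ⟨a, ha⟩ := (hK.image continuous_level).isBounded.subset_closedBall 0
  obtain ⟨b, hb⟩ := (hL.image continuous_level).isBounded.subset_closedBall 0
  have haK : ∀ p ∈ K, |level p| ≤ a := fun p hp ↦ by
    have h := ha (mem_image_of_mem level hp)
    rwa [Metric.mem_closedBall, dist_zero_right, Real.norm_eq_abs] at h
  have hbL : ∀ q ∈ L, |level q| ≤ b := fun q hq ↦ by
    have h := hb (mem_image_of_mem level hq)
    rwa [Metric.mem_closedBall, dist_zero_right, Real.norm_eq_abs] at h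
  -- the translations meeting `L` have `|k| ≤ (a + b) / (2π)`
  set N : ℕ := ⌈(a + b) / (2 * π)⌉₊ with hN
  refine (finite_Icc (-(N : ℤ)) N).subset fun k hk ↦ ?_
  obtain ⟨q, ⟨p, hpK, rfl⟩, hqL⟩ := hk
  have h := two_pi_mul_abs_le_of_abs_level_le (haK p hpK) (hbL _ hqL)
  have hk' : |(k : ℝ)| ≤ (a + b) / (2 * π) := by
    rw [le_div_iff₀ (by positivity : (0 : ℝ) < 2 * π), mul_comm]
    exact h
  have hkN : |(k : ℝ)| ≤ N := hk'.trans (Nat.le_ceil _)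
  rw [mem_Icc, ← abs_le]
  exact_mod_cast hkN

end Literature.Topology.FourManifolds.CircleMaps.CyclicCover
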